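import Summits.ABC.ABC.Theorems.PrimePowerRadical.Negative.WithoutEps

/-!
# `PrimePowerRadical` (stmt-ABC-1648): the exponent `1` is the exact threshold; no `ε`-uniform or explicit constant

Negative support lemmas for the crux `Summit.ABC.ABC.Theses.IneffectiveSubspace.PrimePowerRadical`
(cdisprove seat), complementing `Negative/WithoutEps.lean`:
* `not_const_uniform_in_eps` — no single constant serves every `ε > 0` (limit `ε → 0⁺` + `not_exponent_one`);
* `not_exponent_lt_one` — no exponent `θ < 1` works with any constant (`rad < q^{k+1}`), so with
  `not_exponent_one` the admissible exponents at a prime base `q` are exactly `(1, ∞)` iff the crux holds at `q`;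
* `not_const_one` — the explicit constant `C = 1` fails: witness `(q,k,ε) = (3,2,1/5)`, `rad(1·8·9) = 6`,
  `6^{6/5} < 9`.
-/

noncomputable section

namespace Summit.ABC.ABC.Theorems.PrimePowerRadical.Negative

open Literature.NumberTheory.DiophantineGeometry UniqueFactorizationMonoid Filter Topology

/-- Size of the radical along the family: `rad(1·(q^k−1)·q^k) < q^(k+1)`. [folklore] -/
theorem rad_family_lt {q k : ℕ} (hq : q.Prime) (hk : 1 ≤ k) :
    rad 1 (q ^ k - 1) (q ^ k) < q ^ (k + 1) := by
  rw [rad_family_eq hq hk]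
  have h2 := two_le_pow hq.two_le hk
  have hle : radical (q ^ k - 1) * q ≤ (q ^ k - 1) * q :=
    Nat.mul_le_mul_right q (Nat.radical_le_self_iff.mpr (by omega))
  have : (q ^ k - 1) * q < q ^ k * q := Nat.mul_lt_mul_of_pos_right (by omega) hq.pos
  rw [pow_succ]; omega

/-- The radical along the family is at least `2`. [folklore] -/
theorem two_le_rad_family {q k : ℕ} (hq : 2 ≤ q) (hk : 1 ≤ k) :
    2 ≤ rad 1 (q ^ k - 1) (q ^ k) := by
  have h2 := two_le_pow hq hk
  rw [rad_def, Nat.two_le_radical_iff]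
  calc 2 ≤ q ^ k := h2
    _ = 1 * 1 * q ^ k := by ring
    _ ≤ 1 * (q ^ k - 1) * q ^ k := Nat.mul_le_mul_right _ (by omega)

/-- **No constant uniform in `ε`, at any prime base**: if one `C` served every `ε > 0`, letting
`ε → 0⁺` would give `q^k ≤ C · rad` for all `k`, contradicting `not_exponent_one`.
[cite: GranvilleTucker2002, p. 1227] -/
theorem not_const_uniform_in_eps (q : ℕ) (hq : q.Prime) :
    ¬ ∃ C : ℝ, ∀ ε : ℝ, 0 < ε → ∀ k : ℕ, 1 ≤ k →
      ((q ^ k : ℕ) : ℝ) < C * ((rad 1 (q ^ k - 1) (q ^ k) : ℕ) : ℝ) ^ (1 + ε) := by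
  rintro ⟨C, hC⟩
  refine not_exponent_one q hq ⟨C + 1, fun k hk => ?_⟩
  have hR0 : (0 : ℝ) < ((rad 1 (q ^ k - 1) (q ^ k) : ℕ) : ℝ) := by
    have := two_le_rad_family hq.two_le hk
    exact_mod_cast (by omega : 0 < rad 1 (q ^ k - 1) (q ^ k))
  have hle : ((q ^ k : ℕ) : ℝ) ≤ C * ((rad 1 (q ^ k - 1) (q ^ k) : ℕ) : ℝ) := by
    have ht : Tendsto (fun ε : ℝ => C * ((rad 1 (q ^ k - 1) (q ^ k) : ℕ) : ℝ) ^ (1 + ε))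
        (𝓝[>] 0) (𝓝 (C * ((rad 1 (q ^ k - 1) (q ^ k) : ℕ) : ℝ) ^ (1 + (0 : ℝ)))) := by
      apply Tendsto.const_mul
      have h1 : Tendsto (fun ε : ℝ => 1 + ε) (𝓝[>] (0 : ℝ)) (𝓝 (1 + 0)) :=
        ((continuous_const_add (1 : ℝ)).tendsto 0).mono_left nhdsWithin_le_nhds
      exact (Real.continuousAt_const_rpow hR0.ne').tendsto.comp h1
    rw [add_zero, Real.rpow_one] at ht
    refine ge_of_tendsto ht ?_
    filter_upwards [self_mem_nhdsWithin] with ε hε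
    exact (hC ε hε k hk).le
  calc ((q ^ k : ℕ) : ℝ) ≤ C * ((rad 1 (q ^ k - 1) (q ^ k) : ℕ) : ℝ) := hle
    _ < C * ((rad 1 (q ^ k - 1) (q ^ k) : ℕ) : ℝ) + ((rad 1 (q ^ k - 1) (q ^ k) : ℕ) : ℝ) := by
        linarith
    _ = (C + 1) * ((rad 1 (q ^ k - 1) (q ^ k) : ℕ) : ℝ) := by ring

/-- **No exponent `θ < 1` works, whatever the constant** (for every prime `q`): `rad < q^{k+1}` makes
`C · rad^θ < C q^{(k+1)θ}`, eventually `≤ q^k`. [folklore] -/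
theorem not_exponent_lt_one (q : ℕ) (hq : q.Prime) {θ : ℝ} (hθ : θ < 1) :
    ¬ ∃ C : ℝ, ∀ k : ℕ, 1 ≤ k →
      ((q ^ k : ℕ) : ℝ) < C * ((rad 1 (q ^ k - 1) (q ^ k) : ℕ) : ℝ) ^ θ := by
  rintro ⟨C, hC⟩
  set θ' := max θ 0 with hθ'
  have hθ'0 : 0 ≤ θ' := le_max_right _ _
  have hθ'1 : θ' < 1 := max_lt hθ one_pos
  have hq0 : (0 : ℝ) < q := by exact_mod_cast hq.pos
  have hq1 : (1 : ℝ) < q := by exact_mod_cast hq.one_lt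
  have hlogq : 0 < Real.log q := Real.log_pos hq1
  -- the constant is positive (instance k = 1)
  have hC0 : 0 < C := by
    have h := hC 1 le_rfl
    have hRpos : (0 : ℝ) < ((rad 1 (q ^ 1 - 1) (q ^ 1) : ℕ) : ℝ) := by
      have := two_le_rad_family hq.two_le (le_refl 1)
      exact_mod_cast (by omega : 0 < rad 1 (q ^ 1 - 1) (q ^ 1))
    have hR : (0 : ℝ) < ((rad 1 (q ^ 1 - 1) (q ^ 1) : ℕ) : ℝ) ^ θ := Real.rpow_pos_of_pos hRpos θ
    have hqk : (0 : ℝ) < ((q ^ 1 : ℕ) : ℝ) := by exact_mod_cast pow_pos hq.pos 1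
    by_contra hle
    have : C * ((rad 1 (q ^ 1 - 1) (q ^ 1) : ℕ) : ℝ) ^ θ ≤ 0 :=
      mul_nonpos_of_nonpos_of_nonneg (le_of_not_gt hle) hR.le
    linarith
  -- along the family: q^k < C · q^((k+1)θ'), i.e. (k − (k+1)θ') log q < log C
  have hlog : ∀ k : ℕ, 1 ≤ k →
      (k : ℝ) * ((1 - θ') * Real.log q) < Real.log C + θ' * Real.log q := by
    intro k hk
    have h := hC k hk
    set R : ℝ := ((rad 1 (q ^ k - 1) (q ^ k) : ℕ) : ℝ) with hRdef
    have hR1 : (1 : ℝ) ≤ R := by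
      have := two_le_rad_family hq.two_le hk
      rw [hRdef]; exact_mod_cast (by omega : 1 ≤ rad 1 (q ^ k - 1) (q ^ k))
    have hRlt : R < (q : ℝ) ^ ((k : ℝ) + 1) := by
      have h' : ((rad 1 (q ^ k - 1) (q ^ k) : ℕ) : ℝ) < ((q ^ (k + 1) : ℕ) : ℝ) := by
        exact_mod_cast rad_family_lt hq hk
      have e : ((q ^ (k + 1) : ℕ) : ℝ) = (q : ℝ) ^ ((k : ℝ) + 1) := by
        rw [Nat.cast_pow, ← Real.rpow_natCast]; push_cast; ring_nf
      rwa [e] at h'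
    have step1 : R ^ θ ≤ R ^ θ' := Real.rpow_le_rpow_of_exponent_le hR1 (le_max_left _ _)
    have step2 : R ^ θ' ≤ ((q : ℝ) ^ ((k : ℝ) + 1)) ^ θ' :=
      Real.rpow_le_rpow (by linarith) hRlt.le hθ'0
    have step3 : ((q : ℝ) ^ ((k : ℝ) + 1)) ^ θ' = (q : ℝ) ^ (((k : ℝ) + 1) * θ') := by
      rw [← Real.rpow_mul hq0.le]
    have hqk : ((q ^ k : ℕ) : ℝ) = (q : ℝ) ^ (k : ℝ) := by
      rw [Nat.cast_pow, Real.rpow_natCast]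
    have hmain : (q : ℝ) ^ (k : ℝ) < C * (q : ℝ) ^ (((k : ℝ) + 1) * θ') := by
      calc (q : ℝ) ^ (k : ℝ) = ((q ^ k : ℕ) : ℝ) := hqk.symm
        _ < C * R ^ θ := h
        _ ≤ C * R ^ θ' := by gcongr
        _ ≤ C * ((q : ℝ) ^ ((k : ℝ) + 1)) ^ θ' := by gcongr
        _ = C * (q : ℝ) ^ (((k : ℝ) + 1) * θ') := by rw [step3]
    have hpos : (0 : ℝ) < (q : ℝ) ^ (((k : ℝ) + 1) * θ') := Real.rpow_pos_of_pos hq0 _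
    have hdiv : (q : ℝ) ^ ((k : ℝ) - ((k : ℝ) + 1) * θ') < C := by
      rw [Real.rpow_sub hq0, div_lt_iff₀ hpos]
      exact hmain
    have hlog' := Real.log_lt_log (Real.rpow_pos_of_pos hq0 _) hdiv
    rw [Real.log_rpow hq0] at hlog'
    have e : ((k : ℝ) - ((k : ℝ) + 1) * θ') * Real.log q
        = (k : ℝ) * ((1 - θ') * Real.log q) - θ' * Real.log q := by ring
    linarith
  -- contradiction with Archimedes
  have ha : 0 < (1 - θ') * Real.log q := mul_pos (by linarith) hlogq
  obtain ⟨n, hn⟩ := exists_nat_gt ((Real.log C + θ' * Real.log q) / ((1 - θ') * Real.log q))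
  have h := hlog (n + 1) (by omega)
  rw [div_lt_iff₀ ha] at hn
  push_cast at h
  nlinarith

/-- `rad(1 · 8 · 9) = 6`. [folklore] -/
theorem rad_one_eight_nine : rad 1 8 9 = 6 := by
  have h := rad_family_eq (q := 3) (k := 2) Nat.prime_three (by norm_num)
  norm_num at h
  rw [h, show (8 : ℕ) = 2 ^ 3 by norm_num, radical_pow _ (by norm_num),
    radical_eq_self_of_prime Nat.prime_two]

/-- `6^{6/5} < 9` (since `(3/2)^5 = 7.59375 > 6`). [folklore] -/
theorem six_rpow_lt_nine : (6 : ℝ) ^ ((1 : ℝ) + 1 / 5) < 9 := by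
  set t : ℝ := (6 : ℝ) ^ ((1 : ℝ) / 5) with ht
  have ht5 : t ^ 5 = 6 := by
    rw [ht, ← Real.rpow_natCast, ← Real.rpow_mul (by norm_num)]
    norm_num
  have htlt : t < 3 / 2 := by
    refine lt_of_pow_lt_pow_left₀ 5 (by norm_num) ?_
    rw [ht5]; norm_num
  rw [Real.rpow_add (by norm_num), Real.rpow_one]
  nlinarith

/-- **The explicit constant `C = 1` is false**: "`q^k < rad(1·(q^k−1)·q^k)^{1+ε}` for all primes `q`,
all `ε > 0`, all `k ≥ 1`" fails at `(q, k, ε) = (3, 2, 1/5)` (`rad(1·8·9) = 6`, `6^{6/5} < 9`); with `C = 1`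
the triple `(1,8,9)` needs `ε ≥ log 9/log 6 − 1 ≈ 0.2263` and `(1, 2400, 7^4)` needs `ε ≥ 0.4557`.
[folklore] -/
theorem not_const_one :
    ¬ ∀ q : ℕ, q.Prime → ∀ ε : ℝ, 0 < ε → ∀ k : ℕ, 1 ≤ k →
      ((q ^ k : ℕ) : ℝ) < ((rad 1 (q ^ k - 1) (q ^ k) : ℕ) : ℝ) ^ (1 + ε) := by
  intro h
  have h1 := h 3 Nat.prime_three (1 / 5) (by norm_num) 2 (by norm_num)
  have hrad : ((rad 1 (3 ^ 2 - 1) (3 ^ 2) : ℕ) : ℝ) = 6 := by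
    have e : rad 1 (3 ^ 2 - 1) (3 ^ 2) = rad 1 8 9 := by norm_num
    rw [e, rad_one_eight_nine]; norm_num
  have h9 : ((3 ^ 2 : ℕ) : ℝ) = 9 := by norm_num
  rw [hrad, h9] at h1
  have := six_rpow_lt_nine
  linarith

end Summit.ABC.ABC.Theorems.PrimePowerRadical.Negative

end
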